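import Summits.CriticalPhenomena.PercolationContinuityZ3.Theses.PercVarianceSandwich
import Summits.CriticalPhenomena.PercolationContinuityZ3.Theorems.SubpolynomialBlocking.Negative.Strengthenings
import Literature.Probability.Percolation.MinOpenCut

/-!
# Birth skeleton (BC3) for the crux `CritBlockingNotSuperpolynomial` (stmt-CriticalPhenomena-6066)

Route `route-CriticalPhenomena-PercVarianceSandwich` (crux A, rank 3), sub-problem `PercolationContinuityZ3`,
crux decl `Summit.CriticalPhenomena.PercolationContinuityZ3.Theses.PercVarianceSandwich.CritBlockingNotSuperpolynomial`:
at `p = p_c(ℤ³)` the blocking probabilities `s_n := P_{p_c}(no open path inside Λ_{2n} from Λ_n to ∂ⁱⁿΛ_{2n})`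
of the aspect-2 annulus are NOT super-polynomially small — `∃ k, ∀ K, ∃ n ≥ 1, K / n^k < s_n`, i.e.
`limsup_n n^k s_n = ∞` for some `k` (open in print for `d = 3`; the `d > 6` proliferation picture would make
`s_n` stretched-exponentially small, barrier `SpanningClustersAboveSix`).

THE LINE (bounded min-cut = "pinholes" + finite energy; the route's declared engine for A,
`A ⇐ CritPinholeBlocking → PinholeToPolynomialBlocking → A`, cut one notch finer and weaker).
Write `pinholed k n := {ω | ∃ S, |S| ≤ k, closing S blocks Λ_n from ∂ⁱⁿΛ_{2n} inside Λ_{2n}}`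
(`= {MinCut_n ≤ k}`, `pinholed_eq_setOf_minOpenCutIn_le`: the open min-cut — by Menger the maximal number of
edge-disjoint open crossings — of the critical annulus is at most `k`) and `π_k(n) := P_{p_c}(pinholed k n)`;
`pinholed 0 n` is the blocking event itself (`pinholed_zero`). Two registered stubs:

* STUB 1 `stub_cutTightFrequently` (XL, OPEN — load-bearing, `d = 3`-specific):
  `∃ k, ∃ c > 0, ∃ᶠ n, c ≤ π_k(n)` — along a subsequence of scales the critical annulus has open min-cut
  `≤ k` (at most `k` edge-disjoint open crossings) with probability bounded below. Strictly WEAKER than the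
  route's rank-4 crux `CritPinholeBlocking` (stmt-6067: the same for ALL `n ≥ 1`; `cutTightFrequently_of_critPinholeBlocking`),
  strictly stronger in form than A (A allows `π_0 = s_n → 0` polynomially). It is "tightness at `O(1)` of the
  critical annulus max-flow", versus the only theorem in print, Zhang 2000 (critical flow constant vanishes:
  min-cut `= o(n²)` w.h.p.).
* STUB 2 `stub_pinholeFiniteEnergy` (M–L, PROVABLE NOW — deletion tolerance + union bound + locality):
  `∀ k, ∃ C a, ∀ n ≥ 1, π_k(n) ≤ C · n^a · s_n`: a pinhole configuration is turned into a blocked one by closing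
  the `≤ k` pinholes, each costing a factor `(1 - p_c)⁻¹` (`DeletionTolerance.bondPercolation_pow_mul_real_preimage_closeEdges_le`)
  and an entropy factor `≤ #E(Λ_{2n}) + 1 ≤ 376 n³` (a.s. `ω ⊆ E(ℤ³)` and `openConnIn Λ_{2n}` reads only the edges
  inside `Λ_{2n}`, so `S` may be replaced by `S ∩ E(Λ_{2n})`); `a = 3k`, `C = (376/(1-p_c))^k` work.

Composition (kernel-checked, no `sorry` outside the stubs): `CritBlockingNotSuperpolynomial_of :
stub_cutTightFrequently → stub_pinholeFiniteEnergy → CritBlockingNotSuperpolynomial` with exponent `a + 1`: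
given `K`, pick (frequently) `n > K·C/c`, `n ≥ 1` with `c ≤ π_k(n) ≤ C n^a s_n`; then `C > 0` and
`K/n^{a+1} = (K/n)/n^a < (c/C)/n^a ≤ s_n`.

By-products (2–3 lines each, recorded because they tie the line to the route's items): the route's support item
`PinholeToPolynomialBlocking` (stmt-6071) follows from STUB 2 alone (`pinholeToPolynomialBlocking_of`), and
`CritPinholeBlocking → STUB 1` (`cutTightFrequently_of_critPinholeBlocking`).

DISPROOF USED: none exists for this crux (`ledger crux ls stmt-CriticalPhenomena-6066`: no workfiles, no
`Disproof.lean`, no landed Negative lemma, no ideas, 2026-08-17). Checked against the nearest negative knowledge: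
the refuted strengthenings of the sibling crux `SubpolynomialBlocking` (imported:
`Negative.not_uniform_in_s`, `not_exponent_zero`, `not_forall_n` concern the `∀ s ∀ᶠ n n^{-s} ≤ u_n` family and are
not instantiated by either stub — STUB 1 quantifies `∃ k ∃ c ∃ᶠ n`, STUB 2 is an upper bound); the negatives index
(11 entries) has nothing on min-cuts/pinholes; `not_TiltGluing` (raw-configuration inclusions fail because of
non-lattice pairs) is honoured: both stubs are statements about `P_{p_c}`-probabilities, and STUB 2's proof sketch
passes through the a.s. lattice reduction explicitly.
-/

noncomputable section

namespace Summit.CriticalPhenomena.PercolationContinuityZ3.Cruxes.CritBlockingNotSuperpolynomial.Birth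

open MeasureTheory Filter Literature.Probability.Percolation Literature.Probability.LatticeModels
open Summit.CriticalPhenomena.PercolationContinuityZ3.Theses.PercVarianceSandwich
  (CritBlockingNotSuperpolynomial CritPinholeBlocking PinholeToPolynomialBlocking)
open Summit.CriticalPhenomena.PercolationContinuityZ3.Theorems.SubpolynomialBlocking (Negative.blockProb)

/-! ## Objects of the line (local names; the registered stubs below are their unfoldings) -/

/-- The critical measure `P_{p_c(ℤ³)}`. -/
abbrev μc : Measure (BondConfig (Site 3)) := bondPercolation (zdGraph 3) (criticalProbI 3)

/-- `blocked n`: no open path inside `Λ_{2n}` from `Λ_n` to `∂ⁱⁿΛ_{2n}` — verbatim the crux's event. -/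
abbrev blocked (n : ℕ) : Set (BondConfig (Site 3)) :=
  {ω | ¬ ∃ x ∈ box 3 n, ∃ y ∈ innerBoundary (zdGraph 3) (box 3 (2 * n)),
    ω ∈ openConnIn (↑(box 3 (2 * n)) : Set (Site 3)) x y}

/-- `pinholed k n`: some set `S` of at most `k` pairs, once closed, blocks `Λ_n` from `∂ⁱⁿΛ_{2n}` inside
`Λ_{2n}` — verbatim the event of the route's `CritPinholeBlocking`; `= {MinCut_n ≤ k}`. -/
abbrev pinholed (k n : ℕ) : Set (BondConfig (Site 3)) :=
  {ω | ∃ S : Finset (Sym2 (Site 3)), S.card ≤ k ∧ ¬ ∃ x ∈ box 3 n,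
    ∃ y ∈ innerBoundary (zdGraph 3) (box 3 (2 * n)),
      ω \ (↑S : Set (Sym2 (Site 3))) ∈ openConnIn (↑(box 3 (2 * n)) : Set (Site 3)) x y}

/-- `s n := P_{p_c}(blocked n)`. -/
abbrev s (n : ℕ) : ℝ := μc.real (blocked n)

/-- `π k n := P_{p_c}(pinholed k n) = P_{p_c}(MinCut_n ≤ k)`. -/
abbrev π (k n : ℕ) : ℝ := μc.real (pinholed k n)

/-- The crux, read through `s` (definitional). -/
theorem crux_iff : CritBlockingNotSuperpolynomial ↔ ∃ k : ℕ, ∀ K : ℝ, ∃ n : ℕ, 1 ≤ n ∧ K / (n : ℝ) ^ k < s n :=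
  Iff.rfl

/-- `s n` is the sibling crux's `u_n = blockProb 3 p_c n` (definitional; imports its negative knowledge). -/
theorem s_eq_blockProb (n : ℕ) : s n = Negative.blockProb 3 (criticalProbI 3) n := rfl

/-! ## The two stub statements -/

/-- STUB 1 statement — TIGHTNESS OF THE CRITICAL MIN-CUT AT `O(1)` ALONG A SUBSEQUENCE: for some `k` and
`c > 0`, for infinitely many `n`, with probability `≥ c` closing at most `k` edges blocks the annulus. -/
abbrev CutTightFrequently : Prop :=
  ∃ (k : ℕ) (c : ℝ), 0 < c ∧ ∃ᶠ n : ℕ in Filter.atTop, c ≤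
    (bondPercolation (zdGraph 3) (criticalProbI 3)).real {ω | ∃ S : Finset (Sym2 (Site 3)), S.card ≤ k ∧
      ¬ ∃ x ∈ box 3 n, ∃ y ∈ innerBoundary (zdGraph 3) (box 3 (2 * n)),
        ω \ (↑S : Set (Sym2 (Site 3))) ∈ openConnIn (↑(box 3 (2 * n)) : Set (Site 3)) x y}

/-- STUB 2 statement — FINITE ENERGY FOR PINHOLES: closing the `≤ k` pinholes costs at most a polynomial
factor, `π_k(n) ≤ C n^a s_n` for `n ≥ 1`. -/
abbrev PinholeFiniteEnergy : Prop :=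
  ∀ k : ℕ, ∃ (C : ℝ) (a : ℕ), ∀ n : ℕ, 1 ≤ n →
    (bondPercolation (zdGraph 3) (criticalProbI 3)).real {ω | ∃ S : Finset (Sym2 (Site 3)), S.card ≤ k ∧
      ¬ ∃ x ∈ box 3 n, ∃ y ∈ innerBoundary (zdGraph 3) (box 3 (2 * n)),
        ω \ (↑S : Set (Sym2 (Site 3))) ∈ openConnIn (↑(box 3 (2 * n)) : Set (Site 3)) x y}
      ≤ C * (n : ℝ) ^ a *
        (bondPercolation (zdGraph 3) (criticalProbI 3)).real {ω | ¬ ∃ x ∈ box 3 n,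
          ∃ y ∈ innerBoundary (zdGraph 3) (box 3 (2 * n)),
            ω ∈ openConnIn (↑(box 3 (2 * n)) : Set (Site 3)) x y}

/-- Readings through the local names (definitional). -/
theorem cutTightFrequently_iff :
    CutTightFrequently ↔ ∃ (k : ℕ) (c : ℝ), 0 < c ∧ ∃ᶠ n : ℕ in atTop, c ≤ π k n := Iff.rfl

theorem pinholeFiniteEnergy_iff :
    PinholeFiniteEnergy ↔ ∀ k : ℕ, ∃ (C : ℝ) (a : ℕ), ∀ n : ℕ, 1 ≤ n → π k n ≤ C * (n : ℝ) ^ a * s n :=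
  Iff.rfl

/-! ## Registered stubs -/

/-- **STUB 1 `cutTightFrequently`** (XL, OPEN — load-bearing, `d = 3`-specific):
`∃ k, ∃ c > 0, ∃ᶠ n, P_{p_c}(∃ S, |S| ≤ k, closing S blocks Λ_n from ∂ⁱⁿΛ_{2n} in Λ_{2n}) ≥ c`, i.e. along a
subsequence the open min-cut of the critical annulus (= the maximal number of edge-disjoint open crossings,
Menger) is `≤ k` with probability bounded below. Why plausibly true: in `d = 3` the critical annulus is
expected to carry a TIGHT number of disjoint spanning clusters/crossings (hyperscaling; universal spanning
and wrapping probabilities strictly inside `(0,1)`, Wang et al. 2013, arXiv:1302.0421 p.5), so a bounded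
bottleneck has positive probability; it is the natural target of a 3-D RSW "with `k` surviving defects"
(cut-sets glue for free in any dimension, `IsOpenCutsetIn.iUnion_of_routing`). Why it might fail: iff the
critical annulus carries `→ ∞` edge-disjoint open crossings in probability along every subsequence — the
`d > 6` world (`≈ L^{d-6}` spanning clusters under `η = 0`, Aizenman 1997 Thm 4; barrier
`SpanningClustersAboveSix`), or a jump world `θ(p_c) > 0` whose infinite cluster crosses with unbounded
multiplicity; only min-cut `= o(n²)` is known (Zhang 2000). Weaker than `CritPinholeBlocking` (stmt-6067). -/
theorem stub_cutTightFrequently : CutTightFrequently := by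
  sorry

/-- **STUB 2 `pinholeFiniteEnergy`** (M–L, PROVABLE NOW): `∀ k, ∃ C a, ∀ n ≥ 1, π_k(n) ≤ C n^a s_n`.
Proof sketch: (i) a.s. `ω ⊆ E(ℤ³)` (`DCT16.real_mono_of_forall_subset_edgeSet`), and `openConnIn Λ_{2n}` is
determined by the pairs inside `Λ_{2n}`, so on `pinholed k n` the set `S` may be replaced by
`S ∩ E(Λ_{2n})`, a subset of size `≤ k` of the `≤ 3(4n+1)³` lattice edges of `Λ_{2n}`; (ii) union bound over
the `≤ (#E(Λ_{2n}) + 1)^k ≤ (376 n³)^k` such sets; (iii) for a fixed finite `F`,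
`(1 - p_c)^{|F|} · P(closeEdges F ⁻¹' blocked n) ≤ P(blocked n)`
(`bondPercolation_pow_mul_real_preimage_closeEdges_le`, blocking is measurable) and `p_c(ℤ³) < 1`
(`criticalProb_zd_lt_one`). Hence `C = (376 / (1 - p_c))^k`, `a = 3k`. Sources: Grimmett 1999 §2.2
(finite energy), Newman–Tassion–Wu 2017 §2. -/
theorem stub_pinholeFiniteEnergy : PinholeFiniteEnergy := by
  sorry

/-! ### Name-keyed aliases of the stub statements
`__Registered.stub_X` is statement `X` under the registered stub's short name, so that the native skeleton
audit (hypotheses admissible iff registered stubs BY NAME) accepts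
`CritBlockingNotSuperpolynomial_of : __Registered.stub_cutTightFrequently → __Registered.stub_pinholeFiniteEnergy → …`
(device of `Cruxes/BGNOffTheFloor/Lines/birth.lean`; the `@[stub]` attribute is gate-reserved). -/
namespace __Registered

/-- Alias of `CutTightFrequently` keyed by the registered stub name. -/
abbrev stub_cutTightFrequently : Prop := CutTightFrequently
/-- Alias of `PinholeFiniteEnergy` keyed by the registered stub name. -/
abbrev stub_pinholeFiniteEnergy : Prop := PinholeFiniteEnergy

end __Registered

/-! ## Proved plumbing -/

theorem s_nonneg (n : ℕ) : 0 ≤ s n := measureReal_nonneg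

theorem π_nonneg (k n : ℕ) : 0 ≤ π k n := measureReal_nonneg

theorem π_le_one (k n : ℕ) : π k n ≤ 1 := measureReal_le_one

/-- `s_n > 0` for `n ≥ 1` (finite energy floor `(1-p_c)^{|∂_E Λ_n|} ≤ s_n`, sibling negative file). -/
theorem s_pos {n : ℕ} (hn : 1 ≤ n) : 0 < s n :=
  Summit.CriticalPhenomena.PercolationContinuityZ3.Theorems.SubpolynomialBlocking.Negative.blockProb_criticalProb_three_pos
    hn

/-- No pinholes needed is blocked: `pinholed 0 n = blocked n`. -/
theorem pinholed_zero (n : ℕ) : pinholed 0 n = blocked n := by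
  ext ω
  simp only [Set.mem_setOf_eq, Nat.le_zero, Finset.card_eq_zero, exists_eq_left, Finset.coe_empty,
    Set.sdiff_empty]

/-- More pinholes allowed, larger event. -/
theorem pinholed_mono {k k' : ℕ} (h : k ≤ k') (n : ℕ) : pinholed k n ⊆ pinholed k' n :=
  fun _ ⟨S, hS, hb⟩ => ⟨S, hS.trans h, hb⟩

/-- Blocking is the strongest pinhole event: `blocked n ⊆ pinholed k n`, so `s_n ≤ π_k(n)`. -/
theorem blocked_subset_pinholed (k n : ℕ) : blocked n ⊆ pinholed k n :=
  (pinholed_zero n).symm.le.trans (pinholed_mono (Nat.zero_le k) n)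

theorem s_le_π (k n : ℕ) : s n ≤ π k n := measureReal_mono (blocked_subset_pinholed k n)

/-- The pinhole event IS the min-cut budget event `{MinCut_{Λ_{2n}}(Λ_n, ∂ⁱⁿΛ_{2n}) ≤ k}` of
`Literature.Probability.Percolation.MinOpenCut` (`minOpenCutIn_le_iff`). -/
theorem pinholed_eq_setOf_minOpenCutIn_le (k n : ℕ) :
    pinholed k n = {ω | minOpenCutIn (↑(box 3 (2 * n)) : Set (Site 3)) (↑(box 3 n) : Set (Site 3))
      (↑(innerBoundary (zdGraph 3) (box 3 (2 * n))) : Set (Site 3)) ω ≤ k} := by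
  ext ω
  simp only [Set.mem_setOf_eq, minOpenCutIn_le_iff, Finset.mem_coe]

/-- Hence the pinhole events are measurable (local events of the finite box). -/
theorem measurableSet_pinholed (k n : ℕ) : MeasurableSet (pinholed k n) := by
  rw [pinholed_eq_setOf_minOpenCutIn_le]
  exact measurableSet_setOf_minOpenCutIn_le (Finset.finite_toSet _) _ _ k

/-- STUB 1 is a consequence of the route's rank-4 crux `CritPinholeBlocking` (stmt-6067), which asks the
same bound for every `n ≥ 1`. -/
theorem cutTightFrequently_of_critPinholeBlocking (h : CritPinholeBlocking) : CutTightFrequently := by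
  obtain ⟨k, c, hc, hall⟩ := h
  refine ⟨k, c, hc, Filter.frequently_atTop.2 fun N => ⟨max N 1, le_max_left _ _, ?_⟩⟩
  exact hall (max N 1) (le_max_right _ _)

/-! ## The composition, by name -/

/-- Real arithmetic of the composition: from `c ≤ C n^a s`, `0 < c`, `0 ≤ s`, `K C / c < n`, `1 ≤ n`
conclude `K / n^(a+1) < s`. -/
theorem div_pow_succ_lt_of_sandwich {c C K sn : ℝ} {n a : ℕ} (hc : 0 < c) (hs0 : 0 ≤ sn)
    (hn1 : 1 ≤ n) (hsand : c ≤ C * (n : ℝ) ^ a * sn) (hKn : K * C / c < n) :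
    K / (n : ℝ) ^ (a + 1) < sn := by
  have hn : (0 : ℝ) < n := by exact_mod_cast hn1
  have hna : (0 : ℝ) < (n : ℝ) ^ a := pow_pos hn a
  have hC : 0 < C := by
    by_contra hC
    push Not at hC
    have : C * (n : ℝ) ^ a * sn ≤ 0 :=
      mul_nonpos_of_nonpos_of_nonneg (mul_nonpos_of_nonpos_of_nonneg hC hna.le) hs0
    linarith
  -- `K C < c n`, i.e. `K / n < c / C`
  have h1 : K * C < c * n := by
    have := (div_lt_iff₀ hc).1 hKn
    linarith [mul_comm (n : ℝ) c]
  have h2 : K / (n : ℝ) < c / C := by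
    rw [div_lt_div_iff₀ hn hC]
    linarith [mul_comm c (n : ℝ)]
  -- `c / C / n^a ≤ s`
  have h3 : c / C / (n : ℝ) ^ a ≤ sn := by
    rw [div_div, div_le_iff₀ (mul_pos hC hna)]
    linarith [mul_comm sn (C * (n : ℝ) ^ a)]
  calc K / (n : ℝ) ^ (a + 1) = K / (n : ℝ) / (n : ℝ) ^ a := by
        rw [pow_succ, div_div, mul_comm]
    _ < c / C / (n : ℝ) ^ a := div_lt_div_of_pos_right h2 hna
    _ ≤ sn := h3

/-- **`CritBlockingNotSuperpolynomial_of`**: the two registered stubs imply the crux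
`Summit.CriticalPhenomena.PercolationContinuityZ3.Theses.PercVarianceSandwich.CritBlockingNotSuperpolynomial`
(kernel-checked; no `sorry` outside the stubs). Exponent `a + 1`; scale chosen frequently beyond `K C / c`. -/
theorem CritBlockingNotSuperpolynomial_of (hT : __Registered.stub_cutTightFrequently)
    (hF : __Registered.stub_pinholeFiniteEnergy) :
    Summit.CriticalPhenomena.PercolationContinuityZ3.Theses.PercVarianceSandwich.CritBlockingNotSuperpolynomial := by
  obtain ⟨k, c, hc, hfreq⟩ := hT
  obtain ⟨C, a, hCa⟩ := hF k
  refine ⟨a + 1, fun K => ?_⟩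
  obtain ⟨n, hnN, hπ⟩ := (Filter.frequently_atTop.1 hfreq) (max 1 (⌈K * C / c⌉₊ + 1))
  have hn1 : 1 ≤ n := le_trans (le_max_left _ _) hnN
  have hceil : ⌈K * C / c⌉₊ + 1 ≤ n := le_trans (le_max_right _ _) hnN
  have hKn : K * C / c < n := by
    have h1 : K * C / c ≤ (⌈K * C / c⌉₊ : ℝ) := Nat.le_ceil _
    have h2 : ((⌈K * C / c⌉₊ + 1 : ℕ) : ℝ) ≤ n := by exact_mod_cast hceil
    push_cast at h2
    linarith
  exact ⟨n, hn1, div_pow_succ_lt_of_sandwich hc (s_nonneg n) hn1 (hπ.trans (hCa n hn1)) hKn⟩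

/-- Wiring check: the registered stubs feed the composition as stated. -/
example : Summit.CriticalPhenomena.PercolationContinuityZ3.Theses.PercVarianceSandwich.CritBlockingNotSuperpolynomial :=
  CritBlockingNotSuperpolynomial_of stub_cutTightFrequently stub_pinholeFiniteEnergy

/-! ## By-products tying the line to the route's other items -/

/-- STUB 2 alone proves the route's support item `PinholeToPolynomialBlocking` (stmt-6071:
`CritPinholeBlocking → CritBlockingNotSuperpolynomial`). -/
theorem pinholeToPolynomialBlocking_of (hF : PinholeFiniteEnergy) : PinholeToPolynomialBlocking :=
  fun h => CritBlockingNotSuperpolynomial_of (cutTightFrequently_of_critPinholeBlocking h) hF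

/-- Hence, on this line, the route's rank-4 crux implies the rank-3 crux given STUB 2 only. -/
theorem crux_of_critPinholeBlocking (hF : PinholeFiniteEnergy) (h : CritPinholeBlocking) :
    CritBlockingNotSuperpolynomial :=
  pinholeToPolynomialBlocking_of hF h

end Summit.CriticalPhenomena.PercolationContinuityZ3.Cruxes.CritBlockingNotSuperpolynomial.Birth

end
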